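import Summits.Ventures.PercRepro.RankLevelSetExplicitLin2IndepFloor58
import Summits.Ventures.PercRepro.RankLevelSetExplicitLin2Bases58Seventeen
import Summits.Ventures.PercRepro.RankLevelSetExplicitLin2IndepRow58Seventeen

/-!
# PercRepro — THE 5/8 CHAIN AT LEVEL `17`: THE ROW AT `82 928` AND THE TABLE `Pfloor58S` (p9, S4; the key is p4's)

`proofs/SUBCLAIM-S4-p9.md` §S4.2⁗⁗. The level-`17` step of the 5/8 chain (RankLevelSetExplicitLin2IndepFloor58): p4's key `KeyL 17`
evaluated on the coranks `18 ≤ d ≤ 81 937` (RankLevelSetExplicitLin2IndepRow58Seventeen, 40 chunks of 2 048), the optimal Chernoff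
pair at `D' = 17 + 5·2^{14} = 81 937` (`n₀ = 164 865`, `K₀ = 81 954`), the bases `N₁ = 82 187`, `P₂ = 81 973`
(RankLevelSetExplicitLin2Bases58Seventeen), composed on the level-16 row `c025_sixteen_indep58_from_41686`:
`c025_seventeen_indep58_from_82928`; the table `Pfloor58S` (= `Pfloor58` with `82 928` at `q = 17`), `c025_floor58S`,
`c025_of_window_floor58S`. Axioms: standard.
-/

open scoped Matroid

namespace PercRepro

namespace ThmN

variable {α : Type}

/-- **THE LEVEL-17 STEP OVER THE 5/8 RANGE FROM `82 928`**: level `17` for every finite matroid and every `p ≥ 82 928` from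
level `16` for every `p ≥ 82 927` — the row `key_seventeen_indep58_row` on the coranks `18 … 81 937`, the optimal Chernoff pair at
the top corank `D' = 81 937` (`n₀ = 164 865`, `K₀ = 81 954`), the bases `N₁ = 82 187`, `P₂ = 81 973`, all by the kernel. -/
theorem c025_seventeen_indep58_step (hprev : ∀ (M : Matroid α) [M.Finite] (p : ℕ), 82927 ≤ p → RLS M p 16) :
    ∀ (M : Matroid α) [M.Finite] (p : ℕ), 82928 ≤ p → RLS M p 17 :=
  c025_level_succ_of_keyL_row_tailOpt58 16 (by norm_num) 82928 82187 81973 (by norm_num) (by norm_num)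
    Explicit.base_one58_seventeen (by norm_num) (by norm_num) Explicit.base_two58_seventeen (by norm_num) (by norm_num)
    (by decide +kernel) Explicit.key_seventeen_indep58_row hprev

/-- **THE LEVEL-17 ROW OVER THE 5/8 RANGE FROM `82 928`**: C-025 at level `17` for every finite matroid and every `p ≥ 82 928`
(p4's row at `D = 17 + 2^17`: `132 332`; THEOREM U: `17·2^18 + 1 = 4 456 449`) — the step on the level-16 row
`c025_sixteen_indep58_from_41686` (`41 686 ≤ p`) at `p − 1`. -/
theorem c025_seventeen_indep58_from_82928 (M : Matroid α) [M.Finite] (p : ℕ) (hp : 82928 ≤ p) : RLS M p 17 :=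
  c025_seventeen_indep58_step (fun M' _ p' hp' => c025_sixteen_indep58_from_41686 M' p' (by omega)) M p hp

/-- The same in the literal `C025` body: `phiK p 17 · #U(p, 17) ≤ #Y(p, 17)` for every finite matroid and every `p ≥ 82 928`. -/
theorem c025_seventeen_indep58_from_82928' (M : Matroid α) [M.Finite] (p : ℕ) (hp : 82928 ≤ p) :
    phiK p 17 * ({A : Set α | A ⊆ M.E ∧ M.eRk A = (p : ℕ∞) ∧ M.eRk (M.E \ A) = (17 : ℕ∞)}.ncard : ℚ) ≤
      ({A : Set α | A ⊆ M.E ∧ (17 : ℕ∞) < M.eRk A ∧ M.eRk A < (p : ℕ∞)}.ncard : ℚ) :=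
  c025_seventeen_indep58_from_82928 M p hp

/-- **THE 5/8 TABLE WITH LEVEL `17`**: `Pfloor58` at `q ≠ 17`, `82 928` at `q = 17`. -/
def Pfloor58S (q : ℕ) : ℕ := if q = 17 then 82928 else Pfloor58 q

/-- `Pfloor58S ≤ Pfloor58` at every `q`. -/
theorem Pfloor58S_le_Pfloor58 (q : ℕ) : Pfloor58S q ≤ Pfloor58 q := by
  unfold Pfloor58S
  split_ifs with h
  · subst h; unfold Pfloor58; norm_num
  · exact le_rfl

/-- **THE THRESHOLD OF THE 5/8 RANGE WITH LEVEL `17` AT EVERY `q ≥ 7`**: `RLS M p q` for every finite matroid and every `p ≥ Pfloor58S q`. -/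
theorem c025_floor58S (q : ℕ) (hq : 7 ≤ q) (M : Matroid α) [M.Finite] (p : ℕ) (hp : Pfloor58S q ≤ p) : RLS M p q := by
  unfold Pfloor58S at hp
  split_ifs at hp with h
  · subst h; exact c025_seventeen_indep58_from_82928 M p hp
  · exact c025_floor58 q hq M p hp

/-- **THE CRUX AS THE WINDOWS BELOW THE 5/8 TABLE WITH LEVEL `17`**: `C025` follows from the windows `q + 2 ≤ p < Pfloor58S q`. -/
theorem c025_of_window_floor58S
    (hwin : ∀ {α : Type} (M : Matroid α) [M.Finite] (p q : ℕ), q + 2 ≤ p → p < Pfloor58S q →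
      phiK p q * ({A : Set α | A ⊆ M.E ∧ M.eRk A = (p : ℕ∞) ∧ M.eRk (M.E \ A) = (q : ℕ∞)}.ncard : ℚ) ≤
        ({A : Set α | A ⊆ M.E ∧ (q : ℕ∞) < M.eRk A ∧ M.eRk A < (p : ℕ∞)}.ncard : ℚ)) : C025 := by
  refine c025_of_window_floor58 ?_
  intro β M _ p q hpq hlt
  rcases Nat.lt_or_ge p (Pfloor58S q) with h | h
  · exact hwin M p q hpq h
  · exact c025_floor58S q (by
      by_contra hq
      push Not at hq
      have : Pfloor58S q = Pfloor58 q := by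
        unfold Pfloor58S; split_ifs <;> omega
      omega) M p h

/-- The table, as numerals. -/
theorem Pfloor58S_values : Pfloor58S 16 = 41686 ∧ Pfloor58S 17 = 82928 ∧ Pfloor58S 18 = 18 * 2 ^ 19 + 1 := by
  unfold Pfloor58S Pfloor58; norm_num

end ThmN

end PercRepro
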